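import Mathlib
import Summits.CriticalPhenomena.PercolationContinuityZ3.Theorems.PercNearOneGluingNoHeavyLowerTailFatMinorityMovingAnchor
import HarnessLib

/-!
# `NoHeavyLowerTail` (stmt-CriticalPhenomena-4575), line fat-minority-linear — layer bookkeeping at a
# single observer (per-layer factorisation and sums of layers through a fixed neighbour)

Route task `nh-dp-fatminority` (gen 2).  Two identities of the Kozma–Nitzan σ-decomposition at the block
`{o}` that the landed `blockLayerDecomposition` only exports in summed form:

* `singleton_layer_inter_notConn` — for `a, b ≠ o` and a layer `S`:
  `μ({open star of o = S} ∩ {a ↮ b}) = μ{open star of o = S} · P'_S(a ↮ b)`,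
  `P'_S = prodBernoulli (glue (kill w {o}) S)` (`stub_sigmaLaw` + `stub_sigmaGeometry`);
* `sum_singleton_layer_mem` — for `x ≠ o` and any event `F`:
  `Σ_{S ∋ x} μ({open star of o = S} ∩ F) = μ({o–x open} ∩ F)` (`sigmaRec_partition`).
Used by `…FatMinorityDegreeGluing.lean` to pass Harris' inequality through the layer mixture.
No new definitions. [folklore; Grimmett 1999 §2.2]
-/

namespace Summit.CriticalPhenomena.PercolationContinuityZ3.Theorems

open MeasureTheory Set
open Literature.Probability.LatticeModels (prodBernoulli)
open Literature.Probability.Percolation (BondConfig openConn openGraph)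
open scoped BigOperators

noncomputable section
open Classical

variable {n : ℕ}

/-! ## Layer bookkeeping at a single observer -/

/-- **Per-layer factorisation at a single observer.**  For `a, b ≠ o` and a layer `S`,
`μ({open star of o = S} ∩ {a ↮ b}) = μ{open star of o = S} · P'_S(a ↮ b)` with
`P'_S = prodBernoulli (glue (kill w {o}) S)` (domain Markov property + glue/kill push-forward,
`stub_sigmaLaw`, and the conditional geometry `stub_sigmaGeometry`). [folklore; Grimmett 1999 §2.2] -/
theorem singleton_layer_inter_notConn (w : Sym2 (Fin n) → unitInterval) (o a b : Fin n)
    (hao : a ≠ o) (hbo : b ≠ o) (S : Finset (Fin n)) :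
    (prodBernoulli w).real
        ({ω : BondConfig (Fin n) | ∀ x : Fin n, x ∈ S ↔ (x ∉ ({o} : Finset (Fin n)) ∧
            ∃ o' ∈ ({o} : Finset (Fin n)), s(o', x) ∈ ω)} ∩ (openConn a b)ᶜ) =
      (prodBernoulli w).real
          {ω : BondConfig (Fin n) | ∀ x : Fin n, x ∈ S ↔ (x ∉ ({o} : Finset (Fin n)) ∧
            ∃ o' ∈ ({o} : Finset (Fin n)), s(o', x) ∈ ω)} *
        (prodBernoulli (fun e : Sym2 (Fin n) => if (∀ x ∈ e, x ∈ S) ∧ ¬ e.IsDiag then 1 else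
            if (∃ x ∈ e, x ∈ ({o} : Finset (Fin n))) then 0 else w e)).real (openConn a b)ᶜ := by
  have hK : ∀ ω : BondConfig (Fin n), ∀ o₁ ∈ ({o} : Finset (Fin n)), ∀ o₂ ∈ ({o} : Finset (Fin n)),
      o₁ ≠ o₂ → s(o₁, o₂) ∈ ω := by
    intro ω o₁ ho₁ o₂ ho₂ hne
    rw [Finset.mem_singleton] at ho₁ ho₂
    exact absurd (ho₁.trans ho₂.symm) hne
  have haO : a ∉ ({o} : Finset (Fin n)) := by simpa using hao
  have hbO : b ∉ ({o} : Finset (Fin n)) := by simpa using hbo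
  have hgeo : ∀ ω : BondConfig (Fin n),
      (∀ x : Fin n, x ∈ S ↔ (x ∉ ({o} : Finset (Fin n)) ∧ ∃ o' ∈ ({o} : Finset (Fin n)), s(o', x) ∈ ω)) →
      (ω ∈ openConn a b ↔
        ({e | e ∈ ω ∧ ∀ x ∈ e, x ∉ ({o} : Finset (Fin n))} ∪ {e | (∀ x ∈ e, x ∈ S) ∧ ¬ e.IsDiag}) ∈
          openConn a b) :=
    fun ω hL => (stub_sigmaGeometry n {o} S ω hL (hK ω)).2 a b haO hbO
  have hset : ({ω : BondConfig (Fin n) | ∀ x : Fin n, x ∈ S ↔ (x ∉ ({o} : Finset (Fin n)) ∧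
          ∃ o' ∈ ({o} : Finset (Fin n)), s(o', x) ∈ ω)} ∩ (openConn a b)ᶜ) =
      ({ω : BondConfig (Fin n) | ∀ x : Fin n, x ∈ S ↔ (x ∉ ({o} : Finset (Fin n)) ∧
          ∃ o' ∈ ({o} : Finset (Fin n)), s(o', x) ∈ ω)} ∩
        {ω | ({e | e ∈ ω ∧ ∀ x ∈ e, x ∉ ({o} : Finset (Fin n))} ∪
            {e | (∀ x ∈ e, x ∈ S) ∧ ¬ e.IsDiag}) ∈ (openConn a b)ᶜ}) := by
    ext ω
    constructor
    · rintro ⟨hL, h⟩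
      exact ⟨hL, fun h' => h ((hgeo ω hL).2 h')⟩
    · rintro ⟨hL, h⟩
      exact ⟨hL, fun h' => h ((hgeo ω hL).1 h')⟩
  have h := stub_sigmaLaw n w {o} S (openConn a b)ᶜ
  rw [agPartial_glue_singleton w o] at h
  rw [hset]
  exact h

/-- **Summing the layers through a fixed neighbour.**  For `x ≠ o` and any event `F`,
`Σ_{S ∋ x} μ({open star of o = S} ∩ F) = μ({o–x open} ∩ F)`. [folklore] -/
theorem sum_singleton_layer_mem (w : Sym2 (Fin n) → unitInterval) (o x : Fin n) (hxo : x ≠ o)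
    (F : Set (BondConfig (Fin n))) :
    ∑ S : Finset (Fin n), (if x ∈ S then (prodBernoulli w).real
        ({ω : BondConfig (Fin n) | ∀ y : Fin n, y ∈ S ↔ (y ∉ ({o} : Finset (Fin n)) ∧
            ∃ o' ∈ ({o} : Finset (Fin n)), s(o', y) ∈ ω)} ∩ F) else 0) =
      (prodBernoulli w).real ({ω : BondConfig (Fin n) | s(o, x) ∈ ω} ∩ F) := by
  rw [sigmaRec_partition w {o} ({ω : BondConfig (Fin n) | s(o, x) ∈ ω} ∩ F)]
  refine Finset.sum_congr rfl fun S _ => ?_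
  have hxO : x ∉ ({o} : Finset (Fin n)) := by simpa using hxo
  by_cases hxS : x ∈ S
  · rw [if_pos hxS]
    congr 1
    ext ω
    constructor
    · rintro ⟨hL, hF⟩
      refine ⟨hL, ?_, hF⟩
      obtain ⟨-, o', ho', hmem⟩ := (hL x).1 hxS
      rw [Finset.mem_singleton] at ho'
      subst ho'
      exact hmem
    · rintro ⟨hL, -, hF⟩
      exact ⟨hL, hF⟩
  · rw [if_neg hxS]
    have hempty : ({ω : BondConfig (Fin n) | ∀ y : Fin n, y ∈ S ↔ (y ∉ ({o} : Finset (Fin n)) ∧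
          ∃ o' ∈ ({o} : Finset (Fin n)), s(o', y) ∈ ω)} ∩
        ({ω : BondConfig (Fin n) | s(o, x) ∈ ω} ∩ F)) = ∅ := by
      ext ω
      simp only [Set.mem_inter_iff, Set.mem_setOf_eq, Set.mem_empty_iff_false, iff_false, not_and]
      intro hL hmem _
      exact hxS ((hL x).2 ⟨hxO, o, Finset.mem_singleton_self o, hmem⟩)
    rw [hempty, measureReal_empty]


end

end Summit.CriticalPhenomena.PercolationContinuityZ3.Theorems
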